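import Summits.AtomisticToContinuum.BoseEinsteinCondensation.Theorems.BECInsertionCorrectorCorrectorClosureHoleModeEquationAux
import HarnessLib

/-!
# Line `insertion-mode-gaussian-domination`, aux `holeMode_weakEquation` — the EXACT weak hole-mode equation of the
# Feynman–Kac ground-state pair (crux `BECInsertionCorrector.CorrectorClosure`, item stmt-AtomisticToContinuum-12058)

Supports (does not close) stmt-AtomisticToContinuum-12058. For a repulsive finite-range `v` with bounded periodisation on
the torus of side `L`, the positive FK ground states `Θ₀` (`N ≥ 1` bodies, `E = E₀(N)`) and `Φ₀` (`N+1` bodies,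
`E' = E₀(N+1)`), a mode `n ∈ ℤ³` (`p = 2πn/L`) and the hole state `a = a(φ_n)Φ₀ = √(N+1) ∫ conj φ_n(x) Φ₀(x, ·) dx`, both
real quadratures `c = Re a/Θ₀`, `Im a/Θ₀` satisfy, against every periodic `C¹` test function `φ`,
`𝓔_Θ₀(c, φ) + (|p|² − (E' − E)) ∫ c φ Θ₀² = −∫ (Re a(φ_n)(WΦ₀)/Θ₀) φ Θ₀²`, `W(x, Y) = ∑ⱼ v^per(x − yⱼ)`
(`holeMode_weakEquation`): the weak, ground-state-transformed form `(−G_N + p² − μ_N) ĥ_p = −(Wh)^_p` of the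
`(N+1)`-body eigen-equation for the insertion amplitude `h = Φ₀/Θ₀`, `G_N = Δ + 2∇log Θ₀·∇`.

Proof: (1) the weak Euler–Lagrange equation of `Φ₀` (`tilt_el_all`, all periodic `C¹` tests) tested with
`ζ = m(x)φ(Y)Θ₀(Y)/Φ₀` for a real `C²` periodic Laplace eigenfunction `m` of the tagged coordinate (`∑∂ₖ²m = −Pm`),
integration by parts in `x`, the split `V_{N+1} = W + V_N(tail)` and Fubini give
`∫∇U·∇ψ + ∫V_N ψU + ∫ψ WU + P∫ψU = E'∫ψU`, `U = ∫ mΦ₀`, `WU = ∫ W mΦ₀`, `ψ = φΘ₀` (`holeMode_stepOne`);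
(2) the weak equation of `Θ₀` tested with `(U/Θ₀)φ` and the polarised product rule give
`∫∇U·∇(φΘ₀) + ∫V_N UφΘ₀ = E∫UφΘ₀ + 𝓔_Θ₀(U/Θ₀, φ)` (`holeMode_stepTwo`); (3) subtract, and specialise `m` to the real
modes `Re(w conj φ_n)`, `w = √(N+1), −i√(N+1)`, `P = |p|²` (the dictionary of the Aux file).
References (shape only): M. Reed, B. Simon, *Methods of Modern Mathematical Physics IV*, §XIII.1; E. B. Davies,
*Heat kernels and spectral theory*, §4.2.
-/

noncomputable section

open MeasureTheory Filter Matrix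
open scoped ENNReal NNReal BigOperators ComplexConjugate

namespace Summit.AtomisticToContinuum.BoseEinsteinCondensation.Theorems.CorrectorClosure.InsertionModeGaussianDomination

open Literature.MathematicalPhysics.QuantumManyBody.BoseGas
open Summit.AtomisticToContinuum.BoseEinsteinCondensation.Theorems.CorrectorClosure.GeometricMeanCorrector
open Summit.AtomisticToContinuum.BoseEinsteinCondensation.Cruxes.PeriodicIRBound.LinearPhFloorWagner.WF
open Summit.AtomisticToContinuum.BoseEinsteinCondensation.Cruxes.HardCoreExtension.ThirdLawCurrentFloor
  (stub_periodicGroundStateRegularity)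
open Summit.AtomisticToContinuum.BoseEinsteinCondensation.Theorems.TorusGroundState
  (periodicEnergy_le_of_isPeriodicGroundStateFK)
open Summit.AtomisticToContinuum.BoseEinsteinCondensation.Theorems.CorrectorClosure.ZeroModeRemovalSusceptibility
  (reb_setIntegral_cellN_succ_right)

variable {N : ℕ} {L : ℝ}

/-! ### Step 1: the `(N+1)`-body Euler–Lagrange equation tested against `m ⊗ ψ` -/

section StepOne

variable {v : ℝ → ℝ≥0∞} {C : ℝ≥0}

/-- **Step 1 (the `(N+1)`-body equation in the hole channel).** For a real positive `C¹` lattice-periodic `(N+1)`-body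
ground state `Φ₀` (bounded periodisation), a `C²` periodic Laplace eigenfunction `m` of the tagged coordinate
(`∑ₖ∂ₖ²m = -P m`), its bath functional `U(Y) = ∫_cell m(x)Φ₀(x,Y)dx` with `∂_{j,k}U = ∫ m ∂_{j+1,k}Φ₀`, the functional
`WU(Y) = ∫_cell W(x,Y) m(x) Φ₀(x,Y) dx` and every `C¹` lattice-periodic `ψ`:
`∫ ∇U·∇ψ + ∫ V_N ψ U + ∫ ψ WU + P ∫ ψ U = E₀(N+1) ∫ ψ U`. [cite: ReedSimonIV1978, §XIII.1 (Rayleigh–Ritz)] -/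
theorem holeMode_stepOne (hL : 0 < L) (hv : Measurable v) (hC : ∀ x, periodizedPotential v L x ≤ C)
    {Φ₀ : Config (N + 1) → ℝ} (ΦT : PeriodicTrialState (N + 1) L) (hΦT : ΦT.ψ = fun X => ((Φ₀ X : ℝ) : ℂ))
    (hΦp : ∀ X, 0 < Φ₀ X) (hΦC1 : ContDiff ℝ 1 Φ₀) (hΦper : IsLatticePeriodic L Φ₀)
    (hEΦ : periodicEnergy v ΦT = periodicGroundStateEnergy v (N + 1) L) (hΦfin : periodicEnergy v ΦT ≠ ⊤)
    {m : Space → ℝ} (hm : ContDiff ℝ 2 m)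
    (hmper : ∀ (x : Space) (k : Fin 3), m (x + EuclideanSpace.single k L) = m x) {P : ℝ}
    (heig : ∀ x, ∑ k : Fin 3, fderiv ℝ (fun y => fderiv ℝ m y (EuclideanSpace.single k 1)) x
      (EuclideanSpace.single k 1) = -P * m x)
    {U : Config N → ℝ} (hU : ∀ Y, U Y = ∫ x in cell L, m x * Φ₀ (Matrix.vecCons x Y))
    (hdU : ∀ (Y : Config N) (j : Fin N) (k : Fin 3),
      pderiv j k U Y = ∫ x in cell L, m x * pderiv j.succ k Φ₀ (Matrix.vecCons x Y))
    {WU : Config N → ℝ}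
    (hWU : ∀ Y, WU Y = ∫ x in cell L, m x *
      ((∑ j : Fin N, (periodizedPotential v L (x - Y j)).toReal) * Φ₀ (Matrix.vecCons x Y)))
    {ψ : Config N → ℝ} (hψ : ContDiff ℝ 1 ψ) (hψper : IsLatticePeriodic L ψ) :
    (∫ Y in cellN N L, gradDot U ψ Y) + (∫ Y in cellN N L, (periodicInteraction v L Y).toReal * ψ Y * U Y) +
        (∫ Y in cellN N L, ψ Y * WU Y) + P * ∫ Y in cellN N L, ψ Y * U Y =
      (periodicEnergy v ΦT).toReal * ∫ Y in cellN N L, ψ Y * U Y := by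
  have hne : ∀ Z, Φ₀ Z ≠ 0 := fun Z => (hΦp Z).ne'
  have hmd : Differentiable ℝ m := hm.differentiable (by norm_num)
  have hψd : Differentiable ℝ ψ := hψ.differentiable one_ne_zero
  have hcontψt : Continuous fun Z : Config (N + 1) => ψ (Fin.tail Z) := (tilt_contDiff_comp_tail hψ).continuous
  have hcontG : Continuous fun Z : Config (N + 1) => m (Z 0) * Φ₀ Z :=
    (hm.continuous.comp (continuous_apply 0)).mul hΦC1.continuous
  -- `ΦT` is real positive with modulus `Φ₀`
  have hreal : ∀ X, ΦT.ψ X = (‖ΦT.ψ X‖ : ℂ) := fun X => (realPos_of_ofReal hΦp ΦT hΦT X).1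
  have hF : ∀ Z, ‖ΦT.ψ Z‖ = Φ₀ Z := fun Z => by
    rw [hΦT]; exact (Complex.norm_real _).trans (Real.norm_of_nonneg (hΦp Z).le)
  -- the test function `ζ = η/Φ₀`, `η = m ⊗ ψ`, in the weak Euler–Lagrange equation of `Φ₀`
  set η : Config (N + 1) → ℝ := fun W => m (W 0) * ψ (Fin.tail W) with hηdef
  have hηC : ContDiff ℝ 1 η :=
    ((hm.of_le (by norm_num)).comp (contDiff_apply ℝ Space 0)).mul (tilt_contDiff_comp_tail hψ)
  have hηper : IsLatticePeriodic L η := isLatticePeriodic_mode_mul_tail hmper hψper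
  set ζ : Config (N + 1) → ℝ := fun W => η W / Φ₀ W with hζdef
  have hζper : IsLatticePeriodic L ζ := fun Z i c => by
    show η _ / Φ₀ _ = η Z / Φ₀ Z
    rw [hηper Z i c, hΦper Z i c]
  have hζC : ContDiff ℝ 1 ζ := hηC.div hΦC1 hne
  have hEL := tilt_el_all hv hreal hEΦ hΦfin hζC hζper
  simp only [hF] at hEL
  have hζη2 : ∀ W, ζ W * Φ₀ W ^ 2 = η W * Φ₀ W := fun W => by
    rw [sq, ← mul_assoc, div_mul_cancel₀ (η W) (hne W)]
  rw [show (fun W => ζ W * Φ₀ W) = η from funext fun W => div_mul_cancel₀ (η W) (hne W)] at hEL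
  have eV : ∫ Z in cellN (N + 1) L, (periodicInteraction v L Z).toReal * ζ Z * Φ₀ Z ^ 2 =
      ∫ Z in cellN (N + 1) L, (periodicInteraction v L Z).toReal * (η Z * Φ₀ Z) :=
    integral_congr_ae (ae_of_all _ fun Z => by beta_reduce; rw [mul_assoc, hζη2])
  have eM : ∫ Z in cellN (N + 1) L, ζ Z * Φ₀ Z ^ 2 = ∫ Z in cellN (N + 1) L, η Z * Φ₀ Z :=
    integral_congr_ae (ae_of_all _ hζη2)
  rw [eV, eM] at hEL
  replace hEL : (∫ Z in cellN (N + 1) L, gradDot Φ₀ η Z) +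
      ∫ Z in cellN (N + 1) L, (periodicInteraction v L Z).toReal * (η Z * Φ₀ Z) =
      (periodicEnergy v ΦT).toReal * ∫ Z in cellN (N + 1) L, η Z * Φ₀ Z := hEL
  have hηΦ : ∀ Z, η Z * Φ₀ Z = (m (Z 0) * Φ₀ Z) * ψ (Fin.tail Z) := fun Z => by simp only [hηdef]; ring
  -- (iii) the mass term: Fubini
  have eM1 : ∫ Z in cellN (N + 1) L, η Z * Φ₀ Z = ∫ Y in cellN N L, ψ Y * U Y := by
    simp_rw [hηΦ]
    rw [setIntegral_cellN_mul_tail (integrableOn_cellN (hcontG.mul hcontψt) L)]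
    refine integral_congr_ae (ae_of_all _ fun Y => ?_)
    simp only [Matrix.cons_val_zero, hU]
  -- (ii) the potential term: `V_{N+1} = W + V_N(tail)` and Fubini
  have eV1 : ∫ Z in cellN (N + 1) L, (periodicInteraction v L Z).toReal * (η Z * Φ₀ Z) =
      (∫ Y in cellN N L, ψ Y * WU Y) + ∫ Y in cellN N L, (periodicInteraction v L Y).toReal * ψ Y * U Y := by
    have hsplit : ∀ Z, (periodicInteraction v L Z).toReal * (η Z * Φ₀ Z) =
        m (Z 0) * ((∑ j : Fin N, (periodizedPotential v L (Z 0 - Z j.succ)).toReal) * Φ₀ Z) * ψ (Fin.tail Z) +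
          (m (Z 0) * Φ₀ Z) * ((periodicInteraction v L (Fin.tail Z)).toReal * ψ (Fin.tail Z)) := by
      intro Z
      rw [tilt_toReal_periodicInteraction_succ hC Z, hηΦ]
      ring
    simp_rw [hsplit]
    have i1 : IntegrableOn (fun Z : Config (N + 1) =>
        m (Z 0) * ((∑ j : Fin N, (periodizedPotential v L (Z 0 - Z j.succ)).toReal) * Φ₀ Z) * ψ (Fin.tail Z))
        (cellN (N + 1) L) :=
      (integrableOn_sumPotential_mul_config hv hC (hcontG.mul hcontψt)).congr_fun
        (fun Z _ => by simp only [Pi.mul_apply]; ring) (measurableSet_cellN _ L)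
    have i2 : IntegrableOn (fun Z : Config (N + 1) =>
        (m (Z 0) * Φ₀ Z) * ((periodicInteraction v L (Fin.tail Z)).toReal * ψ (Fin.tail Z))) (cellN (N + 1) L) :=
      (integrableOn_tailInteraction_mul hv hC (hcontG.mul hcontψt)).congr_fun
        (fun Z _ => by simp only [Pi.mul_apply]; ring) (measurableSet_cellN _ L)
    rw [integral_add i1 i2]
    congr 1
    · rw [setIntegral_cellN_mul_tail i1]
      refine integral_congr_ae (ae_of_all _ fun Y => ?_)
      simp only [Matrix.cons_val_zero, Matrix.cons_val_succ, hWU]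
    · rw [setIntegral_cellN_mul_tail (g := fun Z : Config (N + 1) => m (Z 0) * Φ₀ Z)
        (h := fun Y => (periodicInteraction v L Y).toReal * ψ Y) i2]
      refine integral_congr_ae (ae_of_all _ fun Y => ?_)
      simp only [Matrix.cons_val_zero, hU]
  -- (i) the kinetic term: integration by parts in `x`, the eigen-equation of `m`, Fubini, and `∂U = ∫ m ∂Φ₀`
  have hdk : ∀ k : Fin 3, ContDiff ℝ 1 fun y => fderiv ℝ m y (EuclideanSpace.single k 1) := fun k =>
    (hm.fderiv_right (m := 1) (by norm_num)).clm_apply contDiff_const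
  have eK : ∫ Z in cellN (N + 1) L, gradDot Φ₀ η Z =
      P * (∫ Y in cellN N L, ψ Y * U Y) + ∫ Y in cellN N L, gradDot U ψ Y := by
    simp_rw [show ∀ Z, gradDot Φ₀ η Z = _ from fun Z => gradDot_mode_mul_tail Φ₀ hmd hψd Z]
    have iA' : ∀ k : Fin 3, IntegrableOn (fun Z : Config (N + 1) =>
        pderiv 0 k Φ₀ Z * (fderiv ℝ m (Z 0) (EuclideanSpace.single k 1) * ψ (Fin.tail Z))) (cellN (N + 1) L) :=
      fun k => integrableOn_cellN ((continuous_pderiv hΦC1 0 k).mul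
        (((hdk k).continuous.comp (continuous_apply 0)).mul hcontψt)) L
    have iA : IntegrableOn (fun Z : Config (N + 1) => ∑ k : Fin 3,
        pderiv 0 k Φ₀ Z * (fderiv ℝ m (Z 0) (EuclideanSpace.single k 1) * ψ (Fin.tail Z))) (cellN (N + 1) L) :=
      integrable_finsetSum _ fun k _ => iA' k
    have iB : IntegrableOn (fun Z : Config (N + 1) =>
        m (Z 0) * ∑ j : Fin N, ∑ k : Fin 3, pderiv j.succ k Φ₀ Z * pderiv j k ψ (Fin.tail Z)) (cellN (N + 1) L) :=
      integrableOn_cellN ((hm.continuous.comp (continuous_apply 0)).mul (continuous_finsetSum _ fun j _ =>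
        continuous_finsetSum _ fun k _ => (continuous_pderiv hΦC1 _ k).mul
          ((continuous_pderiv hψ j k).comp mixedLaw_continuous_tail))) L
    rw [integral_add iA iB]
    congr 1
    · rw [integral_finsetSum _ fun k _ => iA' k]
      have hIBP : ∀ k : Fin 3, ∫ Z in cellN (N + 1) L,
          pderiv 0 k Φ₀ Z * (fderiv ℝ m (Z 0) (EuclideanSpace.single k 1) * ψ (Fin.tail Z)) =
          -∫ Z in cellN (N + 1) L, Φ₀ Z * (fderiv ℝ (fun y => fderiv ℝ m y (EuclideanSpace.single k 1)) (Z 0)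
            (EuclideanSpace.single k 1) * ψ (Fin.tail Z)) := fun k =>
        integral_pderiv_zero_mul_mode_tail hL hΦC1 hΦper (hdk k)
          (fun x c => fderiv_periodic_of_periodic hmper _ x c) hψ hψper k
      simp only [hIBP]
      have iC : ∀ k : Fin 3, IntegrableOn (fun Z : Config (N + 1) => Φ₀ Z *
          (fderiv ℝ (fun y => fderiv ℝ m y (EuclideanSpace.single k 1)) (Z 0) (EuclideanSpace.single k 1) *
            ψ (Fin.tail Z))) (cellN (N + 1) L) := fun k =>
        integrableOn_cellN (hΦC1.continuous.mul (((((hdk k).continuous_fderiv one_ne_zero).clm_apply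
          continuous_const).comp (continuous_apply 0)).mul hcontψt)) L
      rw [Finset.sum_neg_distrib, ← integral_finsetSum _ (fun k _ => iC k)]
      have hpt2 : ∀ Z : Config (N + 1), ∑ k : Fin 3, Φ₀ Z *
          (fderiv ℝ (fun y => fderiv ℝ m y (EuclideanSpace.single k 1)) (Z 0) (EuclideanSpace.single k 1) *
            ψ (Fin.tail Z)) = -(P * ((m (Z 0) * Φ₀ Z) * ψ (Fin.tail Z))) := by
        intro Z
        rw [← Finset.mul_sum, ← Finset.sum_mul, heig]
        ring
      simp_rw [hpt2]
      rw [integral_neg, neg_neg, integral_const_mul,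
        setIntegral_cellN_mul_tail (integrableOn_cellN (hcontG.mul hcontψt) L)]
      congr 1
      refine integral_congr_ae (ae_of_all _ fun Y => ?_)
      simp only [Matrix.cons_val_zero, hU]
    · rw [reb_setIntegral_cellN_succ_right iB]
      refine integral_congr_ae (ae_of_all _ fun Y => ?_)
      simp only [Matrix.cons_val_zero, mixedLaw_tail_vecCons, Finset.mul_sum]
      have hjk : ∀ (j : Fin N) (k : Fin 3), Integrable (fun x => m x *
          (pderiv j.succ k Φ₀ (Matrix.vecCons x Y) * pderiv j k ψ Y)) (volume.restrict (cell L)) := fun j k =>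
        integrableOn_cell (hm.continuous.mul (((continuous_pderiv hΦC1 _ k).comp
          (continuous_id.matrixVecCons continuous_const)).mul continuous_const))
      rw [integral_finsetSum _ fun j _ => integrable_finsetSum _ fun k _ => hjk j k]
      simp only [integral_finsetSum _ fun k _ => hjk _ k]
      rw [gradDot]
      refine Finset.sum_congr rfl fun j _ => Finset.sum_congr rfl fun k _ => ?_
      rw [hdU, ← integral_mul_const]
      exact integral_congr_ae (ae_of_all _ fun x => by ring)
  rw [eK, eV1, eM1] at hEL
  linarith

end StepOne

/-! ### Step 2: the polarised ground-state representation for the weight `Θ₀`; Step 3: assembly -/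

/-- Polarised product rule: `∇(cF)·∇(φF) = ∇F·∇(cφF) + (∇c·∇φ) F²`. [folklore] -/
theorem gradDot_mul_mul_eq {c φ F : Config N → ℝ} {X : Config N} (hc : DifferentiableAt ℝ c X)
    (hφ : DifferentiableAt ℝ φ X) (hF : DifferentiableAt ℝ F X) :
    gradDot (fun Y => c Y * F Y) (fun Y => φ Y * F Y) X =
      gradDot F (fun Y => c Y * φ Y * F Y) X + gradDot c φ X * F X ^ 2 := by
  have h3 : ∀ (i : Fin N) (k : Fin 3), pderiv i k (fun Y => c Y * φ Y * F Y) X =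
      c X * φ X * pderiv i k F X + F X * (c X * pderiv i k φ X + φ X * pderiv i k c X) := by
    intro i k
    rw [pderiv_fun_mul (φ := fun Y => c Y * φ Y) (hc.fun_mul hφ) hF, pderiv_fun_mul hc hφ]
  simp only [gradDot, pderiv_fun_mul hc hF, pderiv_fun_mul hφ hF, h3, Finset.sum_mul, ← Finset.sum_add_distrib]
  refine Finset.sum_congr rfl fun i _ => Finset.sum_congr rfl fun k _ => ?_
  ring

section StepTwo

variable {v : ℝ → ℝ≥0∞} {C : ℝ≥0}

/-- **Step 2 (polarised ground-state representation w.r.t. `Θ₀`).** For a real positive `C¹` lattice-periodic `N`-body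
ground state `Θ₀`, a `C¹` lattice-periodic `U` and a periodic test function `φ`:
`∫ ∇U·∇(φΘ₀) + ∫ V_N U φ Θ₀ = E₀(N) ∫ U φ Θ₀ + 𝓔_Θ₀(U/Θ₀, φ)` (the weak Euler–Lagrange equation `tilt_el_all` of `Θ₀`
tested with `ζ = (U/Θ₀)φ`; the polarisation of `tilt_identity`). [cite: Davies1989, §4.2 Thm 4.2.1 (proof), pp. 109–110] -/
theorem holeMode_stepTwo (hv : Measurable v) {Θ₀ : Config N → ℝ} (ΘT : PeriodicTrialState N L)
    (hΘT : ΘT.ψ = fun X => ((Θ₀ X : ℝ) : ℂ)) (hΘp : ∀ X, 0 < Θ₀ X) (hΘC1 : ContDiff ℝ 1 Θ₀)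
    (hΘper : IsLatticePeriodic L Θ₀) (hEΘ : periodicEnergy v ΘT = periodicGroundStateEnergy v N L)
    (hΘfin : periodicEnergy v ΘT ≠ ⊤) {U : Config N → ℝ} (hUC1 : ContDiff ℝ 1 U) (hUper : IsLatticePeriodic L U)
    {φ : Config N → ℝ} (hφ : IsPeriodicTest L φ) :
    (∫ Y in cellN N L, gradDot U (fun Y => φ Y * Θ₀ Y) Y) +
        ∫ Y in cellN N L, (periodicInteraction v L Y).toReal * (U Y * φ Y * Θ₀ Y) =
      (periodicEnergy v ΘT).toReal * (∫ Y in cellN N L, U Y * φ Y * Θ₀ Y) +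
        dirichletFormW L Θ₀ (fun Y => U Y / Θ₀ Y) φ := by
  -- adapted from `tilt_identity` (HoleKLS), polarised
  have hne : ∀ Y, Θ₀ Y ≠ 0 := fun Y => (hΘp Y).ne'
  set c : Config N → ℝ := fun Y => U Y / Θ₀ Y with hcdef
  have hcC : ContDiff ℝ 1 c := hUC1.div hΘC1 hne
  have hcU : ∀ Y, c Y * Θ₀ Y = U Y := fun Y => div_mul_cancel₀ (U Y) (hne Y)
  have hreal : ∀ X, ΘT.ψ X = (‖ΘT.ψ X‖ : ℂ) := fun X => (realPos_of_ofReal hΘp ΘT hΘT X).1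
  have hF : ∀ Y, ‖ΘT.ψ Y‖ = Θ₀ Y := fun Y => by
    rw [hΘT]; exact (Complex.norm_real _).trans (Real.norm_of_nonneg (hΘp Y).le)
  have hζ : ContDiff ℝ 1 fun Y => c Y * φ Y := hcC.mul hφ.contDiff
  have hζper : IsLatticePeriodic L fun Y => c Y * φ Y := fun Y i k => by
    show U _ / Θ₀ _ * φ _ = U Y / Θ₀ Y * φ Y
    rw [hUper Y i k, hΘper Y i k, hφ.periodic Y i k]
  have hEL := tilt_el_all hv hreal hEΘ hΘfin hζ hζper
  simp only [hF] at hEL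
  have hkin : ∫ Y in cellN N L, gradDot U (fun Y => φ Y * Θ₀ Y) Y =
      (∫ Y in cellN N L, gradDot Θ₀ (fun Y => c Y * φ Y * Θ₀ Y) Y) + dirichletFormW L Θ₀ c φ := by
    unfold dirichletFormW
    rw [← integral_add (integrableOn_cellN (continuous_gradDot hΘC1 (hζ.mul hΘC1)) L)
      (integrableOn_gradDot_mul_sq hΘC1.continuous hcC hφ.contDiff L)]
    refine integral_congr_ae (ae_of_all _ fun Y => ?_)
    have h := gradDot_mul_mul_eq (hcC.differentiable one_ne_zero Y) (hφ.differentiable Y)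
      (hΘC1.differentiable one_ne_zero Y)
    rwa [show (fun Y => c Y * Θ₀ Y) = U from funext hcU] at h
  have hcφ : ∀ Y, c Y * φ Y * Θ₀ Y ^ 2 = U Y * φ Y * Θ₀ Y := fun Y => by
    calc c Y * φ Y * Θ₀ Y ^ 2 = (c Y * Θ₀ Y) * φ Y * Θ₀ Y := by ring
      _ = U Y * φ Y * Θ₀ Y := by rw [hcU Y]
  have eV : ∫ Y in cellN N L, (periodicInteraction v L Y).toReal * (c Y * φ Y) * Θ₀ Y ^ 2 =
      ∫ Y in cellN N L, (periodicInteraction v L Y).toReal * (U Y * φ Y * Θ₀ Y) :=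
    integral_congr_ae (ae_of_all _ fun Y => by beta_reduce; rw [mul_assoc, hcφ Y])
  have eM : ∫ Y in cellN N L, c Y * φ Y * Θ₀ Y ^ 2 = ∫ Y in cellN N L, U Y * φ Y * Θ₀ Y :=
    integral_congr_ae (ae_of_all _ hcφ)
  rw [eV, eM] at hEL
  replace hEL : (∫ Y in cellN N L, gradDot Θ₀ (fun Y => c Y * φ Y * Θ₀ Y) Y) +
      ∫ Y in cellN N L, (periodicInteraction v L Y).toReal * (U Y * φ Y * Θ₀ Y) =
      (periodicEnergy v ΘT).toReal * ∫ Y in cellN N L, U Y * φ Y * Θ₀ Y := hEL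
  rw [hkin]
  linarith

/-- **Step 3: the weak hole-mode equation for a general real mode `m`.** In the setting of Steps 1–2 (FK pair `Θ₀`,
`Φ₀` read as trial states `ΘT`, `ΦT` attaining `E₀(N)`, `E₀(N+1)`; `m` a `C²` periodic Laplace eigenfunction of the
tagged coordinate with eigenvalue `-P`; `U = ∫ m Φ₀`, `WU = ∫ W m Φ₀`), for every periodic test function `φ`:
`𝓔_Θ₀(U/Θ₀, φ) + (P − (E₀(N+1) − E₀(N))) ∫ (U/Θ₀) φ Θ₀² = −∫ (WU/Θ₀) φ Θ₀²`. [cite: ReedSimonIV1978, §XIII.1 (Rayleigh–Ritz)] -/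
theorem holeMode_weakEquation_of_mode (hL : 0 < L) (hv : Measurable v) (hC : ∀ x, periodizedPotential v L x ≤ C)
    {Θ₀ : Config N → ℝ} (ΘT : PeriodicTrialState N L) (hΘT : ΘT.ψ = fun X => ((Θ₀ X : ℝ) : ℂ))
    (hΘp : ∀ X, 0 < Θ₀ X) (hΘC1 : ContDiff ℝ 1 Θ₀) (hΘper : IsLatticePeriodic L Θ₀)
    (hEΘ : periodicEnergy v ΘT = periodicGroundStateEnergy v N L) (hΘfin : periodicEnergy v ΘT ≠ ⊤)
    {Φ₀ : Config (N + 1) → ℝ} (ΦT : PeriodicTrialState (N + 1) L) (hΦT : ΦT.ψ = fun X => ((Φ₀ X : ℝ) : ℂ))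
    (hΦp : ∀ X, 0 < Φ₀ X) (hΦC1 : ContDiff ℝ 1 Φ₀) (hΦper : IsLatticePeriodic L Φ₀)
    (hEΦ : periodicEnergy v ΦT = periodicGroundStateEnergy v (N + 1) L) (hΦfin : periodicEnergy v ΦT ≠ ⊤)
    {m : Space → ℝ} (hm : ContDiff ℝ 2 m)
    (hmper : ∀ (x : Space) (k : Fin 3), m (x + EuclideanSpace.single k L) = m x) {P : ℝ}
    (heig : ∀ x, ∑ k : Fin 3, fderiv ℝ (fun y => fderiv ℝ m y (EuclideanSpace.single k 1)) x
      (EuclideanSpace.single k 1) = -P * m x)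
    {U : Config N → ℝ} (hUC1 : ContDiff ℝ 1 U) (hUper : IsLatticePeriodic L U)
    (hU : ∀ Y, U Y = ∫ x in cell L, m x * Φ₀ (Matrix.vecCons x Y))
    (hdU : ∀ (Y : Config N) (j : Fin N) (k : Fin 3),
      pderiv j k U Y = ∫ x in cell L, m x * pderiv j.succ k Φ₀ (Matrix.vecCons x Y))
    {WU : Config N → ℝ}
    (hWU : ∀ Y, WU Y = ∫ x in cell L, m x *
      ((∑ j : Fin N, (periodizedPotential v L (x - Y j)).toReal) * Φ₀ (Matrix.vecCons x Y)))
    {φ : Config N → ℝ} (hφ : IsPeriodicTest L φ) :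
    dirichletFormW L Θ₀ (fun Y => U Y / Θ₀ Y) φ +
        (P - ((periodicEnergy v ΦT).toReal - (periodicEnergy v ΘT).toReal)) *
          ∫ Y in cellN N L, U Y / Θ₀ Y * φ Y * Θ₀ Y ^ 2 =
      -∫ Y in cellN N L, WU Y / Θ₀ Y * φ Y * Θ₀ Y ^ 2 := by
  have hΘne : ∀ Y, Θ₀ Y ≠ 0 := fun Y => (hΘp Y).ne'
  have hψper : IsLatticePeriodic L fun Y => φ Y * Θ₀ Y := fun Y i k => by
    show φ _ * Θ₀ _ = φ Y * Θ₀ Y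
    rw [hφ.periodic Y i k, hΘper Y i k]
  have h1 := holeMode_stepOne hL hv hC ΦT hΦT hΦp hΦC1 hΦper hEΦ hΦfin hm hmper heig hU hdU hWU
    (hφ.contDiff.mul hΘC1) hψper
  have h2 := holeMode_stepTwo hv ΘT hΘT hΘp hΘC1 hΘper hEΘ hΘfin hUC1 hUper hφ
  beta_reduce at h1
  have cA : ∫ Y in cellN N L, φ Y * Θ₀ Y * U Y = ∫ Y in cellN N L, U Y * φ Y * Θ₀ Y :=
    integral_congr_ae (ae_of_all _ fun Y => by ring)
  have cB : ∫ Y in cellN N L, (periodicInteraction v L Y).toReal * (φ Y * Θ₀ Y) * U Y =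
      ∫ Y in cellN N L, (periodicInteraction v L Y).toReal * (U Y * φ Y * Θ₀ Y) :=
    integral_congr_ae (ae_of_all _ fun Y => by ring)
  have cW : ∫ Y in cellN N L, φ Y * Θ₀ Y * WU Y = ∫ Y in cellN N L, WU Y * φ Y * Θ₀ Y :=
    integral_congr_ae (ae_of_all _ fun Y => by ring)
  have hdiv : ∀ (u : ℝ) (Y : Config N), u / Θ₀ Y * φ Y * Θ₀ Y ^ 2 = u * φ Y * Θ₀ Y := fun u Y => by
    calc u / Θ₀ Y * φ Y * Θ₀ Y ^ 2 = (u / Θ₀ Y * Θ₀ Y) * φ Y * Θ₀ Y := by ring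
      _ = u * φ Y * Θ₀ Y := by rw [div_mul_cancel₀ u (hΘne Y)]
  have gA : ∫ Y in cellN N L, U Y / Θ₀ Y * φ Y * Θ₀ Y ^ 2 = ∫ Y in cellN N L, U Y * φ Y * Θ₀ Y :=
    integral_congr_ae (ae_of_all _ fun Y => hdiv (U Y) Y)
  have gW : ∫ Y in cellN N L, WU Y / Θ₀ Y * φ Y * Θ₀ Y ^ 2 = ∫ Y in cellN N L, WU Y * φ Y * Θ₀ Y :=
    integral_congr_ae (ae_of_all _ fun Y => hdiv (WU Y) Y)
  rw [cA, cB, cW] at h1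
  rw [gA, gW]
  linarith

end StepTwo

/-! ### The stub -/

/-- **Aux `holeMode_weakEquation` — the exact weak hole-mode equation of the FK ground-state pair.** For a repulsive
finite-range `v` with bounded periodisation on the torus of side `L > 0`, the positive FK ground states `Θ₀` (`N ≥ 1`
bodies, energy `E₀(N)`) and `Φ₀` (`N+1` bodies, energy `E₀(N+1)`), a mode `n ∈ ℤ³` with `p = 2πn/L` and the hole state
`a = a(φ_n)Φ₀`, both real quadratures `c = Re a/Θ₀`, `Im a/Θ₀` satisfy, for every periodic `C¹` test function `φ`,
`𝓔_Θ₀(c, φ) + (|p|² − (E₀(N+1) − E₀(N))) ∫ c φ Θ₀² = −∫ (Re a(φ_n)(WΦ₀)/Θ₀) φ Θ₀²` (resp. `Im`),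
`W(x, Y) = ∑ⱼ v^per(x − yⱼ)`: the weak `y`-Fourier form `(−G_N + p² − μ_N) ĥ_p = −(Wh)^_p` of the `(N+1)`-body
eigen-equation in ground-state-transformed variables (Steps 1–3 with the real modes `m = Re(w conj φ_n)`,
`w = √(N+1)`, `−i√(N+1)`). [cite: ReedSimonIV1978, §XIII.1 (Rayleigh–Ritz)] -/
theorem holeMode_weakEquation (v : ℝ → ℝ≥0∞) (hv : IsRepulsiveFiniteRange v) (N : ℕ) (hN : 1 ≤ N) (L : ℝ) (hL : 0 < L)
    (hb : ∃ C : ℝ≥0, ∀ x, periodizedPotential v L x ≤ C)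
    (Θ₀ : Config N → ℝ) (hΘ : IsPeriodicGroundStateFK v L Θ₀) (hΘp : ∀ X, 0 < Θ₀ X)
    (Φ₀ : Config (N + 1) → ℝ) (hΦ : IsPeriodicGroundStateFK v L Φ₀) (hΦp : ∀ X, 0 < Φ₀ X)
    (n : Fin 3 → ℤ) (φ : Config N → ℝ) (hφ : IsPeriodicTest L φ) :
    (dirichletFormW L Θ₀ (fun Y => (modeAn L (planeWaveMode L n) (fun X => (Φ₀ X : ℂ)) Y).re / Θ₀ Y) φ
        + (‖latticeVec (2 * Real.pi / L) n‖ ^ 2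
            - ((periodicGroundStateEnergy v (N + 1) L).toReal - (periodicGroundStateEnergy v N L).toReal))
          * ∫ Y in cellN N L, (modeAn L (planeWaveMode L n) (fun X => (Φ₀ X : ℂ)) Y).re / Θ₀ Y * φ Y * Θ₀ Y ^ 2
      = - ∫ Y in cellN N L, (modeAn L (planeWaveMode L n)
            (fun X => ((∑ j : Fin N, (periodizedPotential v L (X 0 - X j.succ)).toReal) * Φ₀ X : ℂ)) Y).re
            / Θ₀ Y * φ Y * Θ₀ Y ^ 2) ∧
    (dirichletFormW L Θ₀ (fun Y => (modeAn L (planeWaveMode L n) (fun X => (Φ₀ X : ℂ)) Y).im / Θ₀ Y) φ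
        + (‖latticeVec (2 * Real.pi / L) n‖ ^ 2
            - ((periodicGroundStateEnergy v (N + 1) L).toReal - (periodicGroundStateEnergy v N L).toReal))
          * ∫ Y in cellN N L, (modeAn L (planeWaveMode L n) (fun X => (Φ₀ X : ℂ)) Y).im / Θ₀ Y * φ Y * Θ₀ Y ^ 2
      = - ∫ Y in cellN N L, (modeAn L (planeWaveMode L n)
            (fun X => ((∑ j : Fin N, (periodizedPotential v L (X 0 - X j.succ)).toReal) * Φ₀ X : ℂ)) Y).im
            / Θ₀ Y * φ Y * Θ₀ Y ^ 2) := by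
  obtain ⟨C, hC⟩ := hb
  have hw : Measurable v := hv.1
  -- `C¹` regularity of the two Feynman–Kac ground states, their trial states and energies
  have hΘC1 : ContDiff ℝ 1 Θ₀ := stub_periodicGroundStateRegularity N L v hN hL hw ⟨C, hC⟩ Θ₀ hΘ
  have hΦC1 : ContDiff ℝ 1 Φ₀ :=
    stub_periodicGroundStateRegularity (N + 1) L v (Nat.le_add_left 1 N) hL hw ⟨C, hC⟩ Φ₀ hΦ
  obtain ⟨ΘT, hΘT⟩ := exists_trialState_of_fk hΘ hΘC1
  obtain ⟨ΦT, hΦT⟩ := exists_trialState_of_fk hΦ hΦC1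
  have hEΘ : periodicEnergy v ΘT = periodicGroundStateEnergy v N L :=
    le_antisymm (periodicEnergy_le_of_isPeriodicGroundStateFK hL hw hC hΘ hΘC1 ΘT hΘT)
      (periodicGroundStateEnergy_le v ΘT)
  have hEΦ : periodicEnergy v ΦT = periodicGroundStateEnergy v (N + 1) L :=
    le_antisymm (periodicEnergy_le_of_isPeriodicGroundStateFK hL hw hC hΦ hΦC1 ΦT hΦT)
      (periodicGroundStateEnergy_le v ΦT)
  have hΘfin : periodicEnergy v ΘT ≠ ⊤ := by rw [hEΘ]; exact hΘ.energy_ne_top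
  have hΦfin : periodicEnergy v ΦT ≠ ⊤ := by rw [hEΦ]; exact hΦ.energy_ne_top
  obtain ⟨⟨hreC1, hreP⟩, himC1, himP⟩ := regular_re_im_modeAn (L := L) hΦC1 hΦ.periodic n
  -- the general identity (Step 3) for the two real modes `m = Re(w conj φ_n)`, `w = √(N+1)` and `w = -i√(N+1)`
  rw [← hEΘ, ← hEΦ]
  exact ⟨holeMode_weakEquation_of_mode hL hw hC ΘT hΘT hΘp hΘC1 hΘ.periodic hEΘ hΘfin ΦT hΦT hΦp hΦC1 hΦ.periodic
      hEΦ hΦfin (contDiff_modeRe L n (Real.sqrt (N + 1) : ℂ)) (modeRe_periodic hL.ne' n _) (laplacian_modeRe L n _)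
      hreC1 hreP
      (fun Y => (re_im_modeAn_ofReal hΦC1.continuous n Y).1) (fun Y j k => (pderiv_re_im_modeAn_ofReal hΦC1 n Y j k).1)
      (fun Y => (re_im_modeAn_sumPotential hw hC hΦC1.continuous n Y).1) hφ,
    holeMode_weakEquation_of_mode hL hw hC ΘT hΘT hΘp hΘC1 hΘ.periodic hEΘ hΘfin ΦT hΦT hΦp hΦC1 hΦ.periodic
      hEΦ hΦfin (contDiff_modeRe L n (-Complex.I * (Real.sqrt (N + 1) : ℂ))) (modeRe_periodic hL.ne' n _)
      (laplacian_modeRe L n _) himC1 himP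
      (fun Y => (re_im_modeAn_ofReal hΦC1.continuous n Y).2) (fun Y j k => (pderiv_re_im_modeAn_ofReal hΦC1 n Y j k).2)
      (fun Y => (re_im_modeAn_sumPotential hw hC hΦC1.continuous n Y).2) hφ⟩

end Summit.AtomisticToContinuum.BoseEinsteinCondensation.Theorems.CorrectorClosure.InsertionModeGaussianDomination

end
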